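import Literature.AnabelianGeometry.AbsoluteAnabelian.ArchimedeanReconstructionAutHolWitness

/-!
# [AbsTopIII] Cor 2.9 as typed: `GlobalArchimedeanCompatibility` is a SCHEMA — its universal
# closure is refuted (FACT-LIST row F-2445, abc-iut cell, rule R5)

The `Prop`-valued structure `ArchimedeanReconstruction.GlobalArchimedeanCompatibility`
(`ArchimedeanReconstruction.lean`, [MochizukiAbsTopIII2015] Corollary 2.9 pp. 64–65) is stated over
an interface datum `D : NFCurveData` AND over free parameters — the local linear holomorphic structure
`L`, the NF-point predicate, the cotangent spaces `cot` with the differential `d`, the predicate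
`vanishesAt`, the scaling datum `scale = (x, n, v⃗) ↦ (1/n)·ₓ v⃗` and the value function `fval` — none
of which is constrained by the structure's binders.  Its universal closure is therefore not a fact
(cell rule R5: a schema is consumed AT NAMED INSTANCES only), and this proof-only file records the
kernel refutation:

* `not_globalArchimedeanCompatibility_of_const_one` — at ANY datum `D` with a point `x₀` satisfying the
  NF-point predicate and a function `f₀`, the reading `vanishesAt := ⊤`, `fval := 1` violates clause (a)
  (`embedding`): the sequence `n ↦ n · f₀((1/n)·ₓ v⃗) = n` would have to converge in `k_v`, but
  `‖2^k‖ = ‖2‖^k → ∞` by the archimedean axiom `one_lt_norm_two` of the interface;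
* `not_forall_globalArchimedeanCompatibility` — the universal closure over all parameters is FALSE,
  instantiated at the toy datum `AutHolWitness.D₂` of `ArchimedeanReconstructionAutHolWitness.lean`
  (two NF-points, `k_v = ℝ`; a witness datum, not a model of a curve) with the tautological structure
  "`ℂ^×` at every point, identity transitions" and zero cotangent spaces.

Instance forms of record (unchanged, consumed BY NAME): the junction theorem
`NFCurveData.globalArchimedeanCompatibility_of_refined` (`ArchimedeanReconstructionCor29Sub.lean`)
derives the structure from the refined rows `NFCurveData.Cor29Refined` of the Cor 2.9 sub-DAG, i.e. at
the parameters print intends (local additive structures of Cor 2.7 (c), `ι_{U_X,x}` computing the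
limits, `fval f x = 0` when `f` vanishes at `x`).

HONEST FRAMING: a statement about OUR typed schema (which parameters it leaves free), not about
print's Corollary 2.9; no bearing on [IUTchIII] Cor 3.12; typed ≠ proved.
-/

namespace Literature.AnabelianGeometry.AbsoluteAnabelian.ArchimedeanReconstruction

open _root_.Filter _root_.Topology

/-- **The schema fails at the junk reading `vanishesAt := ⊤`, `fval := 1`, at every datum with an
NF-point and a function.**  Clause (a) of the typed Cor 2.9 ("`(v⃗, f) ↦ lim_{n→∞} n · f((1/n)·ₓ v⃗)`
… determines a [map] `ι_{U_X,x}`") then asks `n ↦ (n : k_v)` to converge, which the archimedean axiom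
`‖2‖ > 1` of `NFCurveData` forbids (`‖(2^k : ℕ)‖ = ‖2‖^k → ∞`).  The parameters `L`, `cot`, `d`,
`scale` are arbitrary. [cite: MochizukiAbsTopIII2015, Corollary 2.9 (a) pp.64–65] -/
theorem not_globalArchimedeanCompatibility_of_const_one (D : NFCurveData) (x₀ : D.Xtop) (f₀ : D.Fn)
    (L : LocalLinearHolStructure D.Xtop) (isNFPoint : D.Xtop → Prop) (hx₀ : isNFPoint x₀)
    (cot : D.Xtop → Type) [∀ x, AddCommGroup (cot x)] [∀ x, Module D.kv (cot x)]
    (d : ∀ x, D.Fn → cot x) (scale : D.Xtop → ℕ → D.Xtop → D.Xtop) :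
    ¬ GlobalArchimedeanCompatibility D L isNFPoint cot d (fun _ _ => True) scale (fun _ _ => 1) := by
  intro h
  obtain ⟨UX, ι, hx, -, hlim⟩ := h.embedding x₀ hx₀
  -- the would-be limit of `n ↦ n · 1 = n` in `k_v`
  have ht : Tendsto (fun n : ℕ => (n : D.kv)) atTop (𝓝 (ι ⟨x₀, hx⟩ (d x₀ f₀))) := by
    simpa only [mul_one] using hlim ⟨x₀, hx⟩ f₀ trivial
  -- along the subsequence `k ↦ 2^k` the norms are `‖2‖^k → ∞`
  have hsub : Tendsto (fun k : ℕ => ‖(2 : D.kv)‖ ^ k) atTop (𝓝 ‖ι ⟨x₀, hx⟩ (d x₀ f₀)‖) := by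
    have h2 := (ht.norm.comp (tendsto_pow_atTop_atTop_of_one_lt (one_lt_two : (1 : ℕ) < 2)))
    refine h2.congr fun k => ?_
    simp [Function.comp, norm_pow]
  exact not_tendsto_nhds_of_tendsto_atTop (tendsto_pow_atTop_atTop_of_one_lt D.one_lt_norm_two) _ hsub

/-- **The universal closure of the typed Cor 2.9 schema `GlobalArchimedeanCompatibility` is FALSE**
(FACT-LIST row F-2445 of the abc-iut cell: universal closure REFUTED; instance forms = the junction
theorem `NFCurveData.globalArchimedeanCompatibility_of_refined` from the refined rows `Cor29Refined`).
Witness: the toy datum `AutHolWitness.D₂` (NF-point class `pt true`, its one function), the tautological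
local linear holomorphic structure (`𝒜_p = ℂ^×`, identity transitions), every point declared an NF-point,
zero cotangent spaces, `vanishesAt := ⊤`, `scale x n v := x`, `fval := 1`.
[cite: MochizukiAbsTopIII2015, Corollary 2.9 pp.64–65] -/
theorem not_forall_globalArchimedeanCompatibility :
    ¬ ∀ (D : NFCurveData) (L : LocalLinearHolStructure D.Xtop) (isNFPoint : D.Xtop → Prop)
        (cot : D.Xtop → Type) [∀ x, AddCommGroup (cot x)] [∀ x, Module D.kv (cot x)]
        (d : ∀ x, D.Fn → cot x) (vanishesAt : D.Fn → D.Xtop → Prop)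
        (scale : D.Xtop → ℕ → D.Xtop → D.Xtop) (fval : D.Fn → D.Xtop → D.kv),
        GlobalArchimedeanCompatibility D L isNFPoint cot d vanishesAt scale fval := by
  intro h
  -- the tautological local linear holomorphic structure on the toy space `X^top` of `D₂`
  let L₀ : LocalLinearHolStructure AutHolWitness.D₂.Xtop :=
    { A := fun _ => ℂˣ
      isoUnits := fun _ => ContinuousMulEquiv.refl ℂˣ
      trans := fun _ _ => ContinuousMulEquiv.refl ℂˣ
      trans_self := fun _ => rfl
      trans_comp := fun _ _ _ => rfl
      trans_isoUnits := fun _ _ => rfl }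
  exact not_globalArchimedeanCompatibility_of_const_one AutHolWitness.D₂ (AutHolWitness.pt true) ()
    L₀ (fun _ => True) trivial (fun _ => PUnit) (fun _ _ => PUnit.unit) (fun x _ _ => x)
    (h AutHolWitness.D₂ L₀ (fun _ => True) (fun _ => PUnit) (fun _ _ => PUnit.unit) (fun _ _ => True)
      (fun x _ _ => x) (fun _ _ => 1))

/-- **Existential form** (the shape of the cell's STRIKE-if-refuted precedent
`AutHolWitness.exists_not_reconstructsAutHol`): some datum and parameters violate the schema.
[cite: MochizukiAbsTopIII2015, Corollary 2.9 pp.64–65] -/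
theorem exists_not_globalArchimedeanCompatibility :
    ∃ (D : NFCurveData) (L : LocalLinearHolStructure D.Xtop) (isNFPoint : D.Xtop → Prop)
      (cot : D.Xtop → Type) (_ : ∀ x, AddCommGroup (cot x)) (_ : ∀ x, Module D.kv (cot x))
      (d : ∀ x, D.Fn → cot x) (vanishesAt : D.Fn → D.Xtop → Prop)
      (scale : D.Xtop → ℕ → D.Xtop → D.Xtop) (fval : D.Fn → D.Xtop → D.kv),
      ¬ GlobalArchimedeanCompatibility D L isNFPoint cot d vanishesAt scale fval := by
  by_contra hne
  push Not at hne
  exact not_forall_globalArchimedeanCompatibility fun D L isNFPoint cot _ _ d vanishesAt scale fval =>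
    hne D L isNFPoint cot _ _ d vanishesAt scale fval

end Literature.AnabelianGeometry.AbsoluteAnabelian.ArchimedeanReconstruction
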